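import Summits.ResolutionOfSingularities.ResolutionOfSingularities.Theorems.TameInertialLU2
import Summits.ResolutionOfSingularities.ResolutionOfSingularities.Theorems.TameAbelianQuotientLU3
import Summits.ResolutionOfSingularities.ResolutionOfSingularities.Theorems.InvariantDescentLU4
import Summits.ResolutionOfSingularities.ResolutionOfSingularities.Theorems.InertiaIsotypicStability
import Summits.ResolutionOfSingularities.ResolutionOfSingularities.Theorems.StableRestrict
import Summits.ResolutionOfSingularities.ResolutionOfSingularities.Theorems.TameAbelianMonomialChart
import Summits.ResolutionOfSingularities.ResolutionOfSingularities.Theorems.FiniteAutSeparator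
import Mathlib.RingTheory.LocalRing.ResidueField.Basic
import Mathlib.GroupTheory.Perm.Cycle.Type
import Mathlib.RingTheory.RegularLocalRing.Defs
import Mathlib.RingTheory.Ideal.Cotangent
import HarnessLib

/-!
# TameTwoStoreyLU — the TWO-STOREY TAME LAW: an arbitrary finite inert storey `H = G/T` on top of an abelian tame
inertial storey `T` (exponent `e ∈ k×`, `μ_e ⊆ K′`), HYPOTHESIS-FREE, with NO section `H → G` (decomp-res lens 1, g29)

**Node g29 «TameTwoStorey» of the ROOT/RESIDUAL decomposition cell `decomp-res`, lens 1 («grading / quantitative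
ladder»), window (W-α) WHOLE (critic PRE-RULINGs STATUS :1914 (C2)(ii) / :1951, letter rows 213 (t1)–(t8), 215
(A1)–(A7), 216a, 218b, 219c).**  Problem side, sorry-free, HYPOTHESIS-FREE (no `def : Prop` fact binder, no port).

## Thesis
g25/g26 consumed Cossart–Piltant's tame descent for ABELIAN tops `G` acting with residues in `k` and `ζ ∈ k`;
g28-A consumed the INERT storey alone (`T = 1`, residue-free witness) and g28-B the TAME-INERTIAL storey alone
(`G = T` cyclic, `μ_ℓ ⊆ K`).  This node composes the two storeys for an ARBITRARY inert quotient `H = G/T` —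
non-abelian, not complemented, `gcd(|H|, |T|) ≠ 1` allowed — by the «KUMMER–LAGRANGE TWIST»: the descent along `H`
is NOT run on `T`-invariants of a complement-fixed chart (no complement need exist: `G = Q₈`), but on the
`K_T`-COORDINATES of the maximal ideal over FIELD EIGENVECTORS `f_χ ∈ K′` of the abelian inertia (`μ_e ⊆ K′`):
isotypic stability (`InertiaIsotypicStability`, a CONSEQUENCE of (A1)–(A2)) makes the coordinate modules
`N_χ = {n ∈ K_T | f_χ n ∈ 𝔪_B}` `H`-stable up to the twisting units `ε = g f_χ / f_χ ∈ K_T`, Lagrange descent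
along `H` (`InvariantDescentLU.exists_sum_fixed_of_stable`, g28 file 11) produces a SEMI-INVARIANT regular system
of parameters `u_j = f_j m_j` (`m_j` `G`-fixed), the abelian monomial chart of g26 (`TameAbelianMonomialChart`)
kills `T`, and the resulting `T`-fixed model is `G`-STABLE because `g u_j = ε_{g,j} u_j` with `ε^{±1}` in the
model — so ENGINE-2 (`InvariantDescentLU`, g28 files 9–10) descends it along `H` inside `K_T = ι(K)(x_s)`
(`x_s` a `T`-fixed separator of the inert storey, `FiniteAutSeparator`-style orbit sums with `|T| ∈ O′×`), and the
g26 transport brings it down to `K`.  ONE application of the cell's model clause (with the finite `G`-stable set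
`z` of roots of unity, separator, eigenvectors and twisting units).

## Contents
* PART A (generic tools over a valued field `(E, O_E)` with a group acting): `inertiaSubgroup` (+ `mem_…_iff`,
  `conj_mem_…`, `valuation_card_inertiaSubgroup` — `|T| ∈ O_E×` by Cauchy), `exists_inertia_separator`,
  `restrictO`/`resAut` (residual action), `exists_fin_of_span_eq_maximalIdeal` / `ne_zero_of_span_eq_maximalIdeal`
  (Nakayama extraction of a regular system of parameters from a generating set), small valuation lemmas.
* PART B: THE CELL `TameOverInertLUAbove k O` ((A1)–(A3), inertia predicate inline, `z`-enriched model clause),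
  `exists_aeval_eq_of_fixed` (Galois generation by a separator), `relLU_transport` (g26 (6)–(7) generic), THE LAW
  `relLU_of_tameOverInertLUAbove` (`set_option maxHeartbeats 4000000 in` BEFORE its docstring — keep it).
* PART C: the decided piece `NonKHToricArchLUKeyHenselDescentQuotTInertTwoCell` (`_holds`), the located residual
  R30 `NonKHToricArchLUKeyHenselDescentQuotTInertTwo e c n` := R29's binders ∧ `¬ TameOverInertLUAbove k O`
  (docstring = the honest located remainder (α3′) split storey, (β) wild, (γ) defect), the exact cuts
  `R29 ↔ R30` (`nonKHToricArchLUKeyHenselDescentQuotTInert_iff_tame2`, by `by_cases` on the cell + the law),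
  `R28/R25/R23/NonKHToricArchLU ↔ R30`, `…Two_of_root`, ROOT BY NAME `closes_tame2` (binders = `closes_tinert`'s
  with R30 for R29), `root_iff_tame2_sigma`.

## Paper instances (NODE-g29.md §4; the cell binders instantiated by hand there)
Base: `k = 𝔽_p`, `K = k(x, y)`, `O` = the rank-one ARC place `x ↦ t`, `y ↦ η(t)` (`η ∈ t·𝔽_p[[t]]`
transcendental over `𝔽_p(t)`), `Γ_O = ℤ`, `κ(O) = 𝔽_p`; `K₂ := K(ζ) = 𝔽_{p²}(x, y)` (`ζ` a generator of
`𝔽_{p²}×`) is INERT above `O` (residue field `𝔽_{p²}`).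
(i) Kummer–`S₃` (`p ≡ 2 (mod 3)`): `K′ = K₂(β)`, `β³ = x` — Galois over `K` with `G ≅ S₃`, ONE prime `O′` above
`O` (inert, then totally ramified: `v(x) = 1`), `T = Gal(K′/K₂) = C₃` (abelian, exponent `e = 3 ∈ 𝔽_p×`),
`ζ₃ = ζ^{(p²−1)/3} ∈ K′`, `H = Gal(K₂/K) = C₂` acting on `T` by inversion, `κ(O′) = 𝔽_{p²}` algebraic over `k`:
(A1)–(A3) hold; outside g26 (`G` non-abelian), g28-A (`T ≠ 1`), g28-B (`G ≠ T`, `μ₃ ⊄ K`).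
(ii) QUATERNION control (`p ≡ 3 (mod 4)`): `K′ = K₂(β)`, `β⁴ = ζ² x` — Galois over `K` (`σ(ζ²x)/(ζ²x) = (ζ^{(p−1)/2})⁴`)
of degree `8`, ONE prime `O′` above `O` (`e = 4`, `f = 2`), `T = Gal(K′/K₂) = C₄`, `ζ₄ = ζ^{(p²−1)/4} ∈ K′`,
`(4 : 𝔽_p) ≠ 0`, `κ(O′) = 𝔽_{p²}`; every lift `σ̃` of the Frobenius of `K₂/K` satisfies `σ̃² = τ²` (because `ζ` is a
NON-square of `𝔽_{p²}`: `σ̃² β = ζ^{(p²−1)/2} β = −β`) and `σ̃ τ σ̃⁻¹ = τ^p = τ⁻¹`, so `G ≅ Q₈`, the extension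
`1 → C₄ → G → C₂ → 1` is NON-SPLIT (`H²(H, T) ≠ 0`): no complement `H̃` exists and no «complemented» proof applies,
while (A1)–(A3) hold and the law above decides the cell piece.  In both instances the model clause is the INPUT
(`G`-equivariant local uniformization of the surface `K′/𝔽_{p²}` at `O′` applied to `ι(R)[z]` — dimension two).

[WRITER NOTE (decomp-res writer g14): the lens slice S1 (433 l) is re-cut by the gate's 400-line lint for Theorems files with proofs:
this file = PART A up to `exists_inertia_separator`; the two Nakayama extraction lemmas `ne_zero_of_span_eq_maximalIdeal` /
`exists_fin_of_span_eq_maximalIdeal` continue VERBATIM in `TameTwoStoreyLU1B` (same namespace and section frame); three simp/rfl rules got one-line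
docstrings for the gate's docstring lint.  Nothing else changed.]
-/

noncomputable section

open IsLocalRing Polynomial IntermediateField Literature.AlgebraicGeometry.Resolution
open Summit.ResolutionOfSingularities.ResolutionOfSingularities.Theorems.TameQuotientLU
open Summit.ResolutionOfSingularities.ResolutionOfSingularities.Theorems.TameAbelianQuotientLU
open Summit.ResolutionOfSingularities.ResolutionOfSingularities.Theorems.InertiaIsotypicStability
open Summit.ResolutionOfSingularities.ResolutionOfSingularities.Theorems.TameInertialLU
open Summit.ResolutionOfSingularities.ResolutionOfSingularities.Theorems.TameAbelianMonomialChart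

namespace Summit.ResolutionOfSingularities.ResolutionOfSingularities.Theorems.TameTwoStoreyLU

universe u

/-! ## Part A — generic tools over a valued field `(E, O_E)`

`zpow` membership, primes below a non-unit natural number, restriction of `O_E`-stable automorphisms to `O_E` and to the
residue field, the INERTIA SEPARATOR (an `O_E`-element fixed by the inertia group `T` of a finite group `G` of `O_E`-stable
automorphisms and moved to residual distance `1` by every `g ∉ T`), the non-vanishing of the members of a regular system of
parameters, and the Nakayama extraction of a regular system of parameters from a spanning set. -/

section GenericA

variable {E : Type u} [Field E] (OE : ValuationSubring E)

/-- `a, a⁻¹ ∈ S ⟹ a ^ m ∈ S` for every integer `m`. [folklore] -/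
theorem zpow_mem_of_inv_mem {S : Subring E} {a : E} (ha : a ∈ S) (ha' : a⁻¹ ∈ S) (m : ℤ) :
    a ^ m ∈ S := by
  cases m with
  | ofNat n => rw [Int.ofNat_eq_natCast, zpow_natCast]; exact pow_mem ha n
  | negSucc n => rw [zpow_negSucc, ← inv_pow]; exact pow_mem ha' (n + 1)

/-- A natural number which is not a unit of `O_E` has a prime factor which is not a unit of `O_E`. [folklore] -/
theorem exists_prime_dvd_of_valuation_natCast_lt_one :
    ∀ n : ℕ, 0 < n → OE.valuation (n : E) < 1 →
      ∃ p : ℕ, p.Prime ∧ p ∣ n ∧ OE.valuation (p : E) < 1 := by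
  intro n
  induction n using Nat.strong_induction_on with
  | _ n ih =>
    intro hn hv
    have hn1 : n ≠ 1 := by rintro rfl; simp at hv
    obtain ⟨p, hp, m, rfl⟩ := Nat.exists_prime_and_dvd hn1
    by_cases hvp : OE.valuation (p : E) < 1
    · exact ⟨p, hp, dvd_mul_right p m, hvp⟩
    · have hvp1 : OE.valuation (p : E) = 1 :=
        le_antisymm ((OE.valuation_le_one_iff _).mpr (natCast_mem OE p)) (not_lt.mp hvp)
      have hm0 : 0 < m := Nat.pos_of_ne_zero (by rintro rfl; simp at hn)
      have hmn : m < p * m := by nlinarith [hp.two_le]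
      have hvm : OE.valuation (m : E) < 1 := by
        have h := hv
        rw [Nat.cast_mul, map_mul, hvp1, one_mul] at h
        exact h
      obtain ⟨q, hq, hqm, hvq⟩ := ih m hmn hm0 hvm
      exact ⟨q, hq, dvd_mul_of_dvd_right hqm p, hvq⟩

/-- `O_E`-stability of `g` transfers to `g⁻¹`. [folklore] -/
theorem symm_apply_mem_iff (g : E ≃+* E) (hg : ∀ y, y ∈ OE ↔ g y ∈ OE) (y : E) :
    y ∈ OE ↔ g.symm y ∈ OE := by
  constructor
  · intro hy; exact (hg _).mpr (by simpa using hy)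
  · intro hy; simpa using (hg _).mp hy

/-- The restriction of an `O_E`-stable automorphism of `E` to the valuation ring `O_E`. [folklore] -/
def restrictO (g : E ≃+* E) (hg : ∀ y, y ∈ OE ↔ g y ∈ OE) : OE ≃+* OE where
  toFun y := ⟨g y, (hg y).mp y.2⟩
  invFun y := ⟨g.symm y, (symm_apply_mem_iff OE g hg y).mp y.2⟩
  left_inv y := Subtype.ext (by simp)
  right_inv y := Subtype.ext (by simp)
  map_mul' x y := Subtype.ext (by simp)
  map_add' x y := Subtype.ext (by simp)

/-- `restrictO_apply_coe`: simp/rfl bookkeeping rule for the generic inertia tools, VERBATIM from the lens file (docstring added by the writer for the gate's docstring lint); the statement is its type. [new; elementary] [folklore] -/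
@[simp] theorem restrictO_apply_coe (g : E ≃+* E) (hg : ∀ y, y ∈ OE ↔ g y ∈ OE) (y : OE) :
    ((restrictO OE g hg y : OE) : E) = g y := rfl

/-- The residue automorphism `ḡ : κ(O_E) ≃ κ(O_E)` of an `O_E`-stable automorphism `g`. [folklore] -/
def resAut (g : E ≃+* E) (hg : ∀ y, y ∈ OE ↔ g y ∈ OE) : ResidueField OE ≃+* ResidueField OE :=
  ResidueField.mapEquiv (restrictO OE g hg)

/-- `resAut_residue`: simp/rfl bookkeeping rule for the generic inertia tools, VERBATIM from the lens file (docstring added by the writer for the gate's docstring lint); the statement is its type. [new; elementary] [folklore] -/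
theorem resAut_residue (g : E ≃+* E) (hg : ∀ y, y ∈ OE ↔ g y ∈ OE) (y : OE) :
    resAut OE g hg (residue OE y) = residue OE (restrictO OE g hg y) := rfl

/-- `ḡ = 1` iff `g` is INERTIAL (`v(g y − y) < 1` on `O_E`). [folklore] -/
theorem resAut_eq_one_iff (g : E ≃+* E) (hg : ∀ y, y ∈ OE ↔ g y ∈ OE) :
    resAut OE g hg = 1 ↔ ∀ y ∈ OE, OE.valuation (g y - y) < 1 := by
  constructor
  · intro h y hy
    have h1 : residue OE (restrictO OE g hg ⟨y, hy⟩) = residue OE ⟨y, hy⟩ := by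
      rw [← resAut_residue, h]; rfl
    have h2 : restrictO OE g hg ⟨y, hy⟩ - ⟨y, hy⟩ ∈ maximalIdeal OE := by
      rw [← residue_eq_zero_iff, map_sub, h1, sub_self]
    have h3 := (ValuationSubring.valuation_lt_one_iff OE _).mp h2
    simpa using h3
  · intro h
    apply RingEquiv.ext
    intro q
    obtain ⟨y, rfl⟩ := residue_surjective q
    rw [resAut_residue]
    have h1 : residue OE (restrictO OE g hg y) - residue OE y = 0 := by
      rw [← map_sub, residue_eq_zero_iff]
      exact (ValuationSubring.valuation_lt_one_iff OE _).mpr (by simpa using h y y.2)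
    exact (sub_eq_zero.mp h1).trans rfl

/-- Residue automorphisms compose. [folklore] -/
theorem resAut_comp {g h gh : E ≃+* E} (hg : ∀ y, y ∈ OE ↔ g y ∈ OE) (hh : ∀ y, y ∈ OE ↔ h y ∈ OE)
    (hgh : ∀ y, y ∈ OE ↔ gh y ∈ OE) (hcomp : ∀ y, gh y = g (h y)) :
    resAut OE gh hgh = resAut OE g hg * resAut OE h hh := by
  apply RingEquiv.ext
  intro q
  obtain ⟨y, rfl⟩ := residue_surjective q
  rw [RingAut.mul_apply, resAut_residue, resAut_residue, resAut_residue]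
  exact congrArg (residue OE) (Subtype.ext (hcomp y))

/-- An element of `O_E` outside the maximal ideal has value `1`. [folklore] -/
theorem valuation_eq_one_of_not_lt {y : E} (hy : y ∈ OE) (h : ¬ OE.valuation y < 1) :
    OE.valuation y = 1 :=
  le_antisymm ((OE.valuation_le_one_iff _).mpr hy) (not_lt.mp h)

/-- **The inertia subgroup** `T = {g | v(g y − y) < 1 on O_E}` of a group `G` acting on `E` by `O_E`-stable
automorphisms. [folklore; ZS75 VI §12] -/
def inertiaSubgroup {G : Type*} [Group G] (φ : G →* (E ≃+* E))
    (hGO : ∀ g : G, ∀ y : E, y ∈ OE ↔ φ g y ∈ OE) : Subgroup G where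
  carrier := {g | ∀ y ∈ OE, OE.valuation (φ g y - y) < 1}
  mul_mem' := by
    intro g h hg hh y hy
    have h1 : φ (g * h) y - y = φ g (φ h y - y) + (φ g y - y) := by
      rw [map_mul, RingAut.mul_apply, map_sub]; ring
    rw [Set.mem_setOf_eq] at hg hh
    rw [h1]
    refine lt_of_le_of_lt (Valuation.map_add _ _ _) (max_lt ?_ (hg y hy))
    exact InvariantDescentLU.valuation_apply_lt_one OE (hGO g) (hh y hy)
  one_mem' := fun y _ => by simp
  inv_mem' := by
    intro g hg y hy
    rw [Set.mem_setOf_eq] at hg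
    have hw : φ g⁻¹ y ∈ OE := (hGO g⁻¹ y).mp hy
    have h1 : φ g⁻¹ y - y = -(φ g (φ g⁻¹ y) - φ g⁻¹ y) := by
      rw [← RingAut.mul_apply, ← map_mul, mul_inv_cancel, map_one, RingAut.one_apply]; ring
    rw [h1, Valuation.map_neg]
    exact hg _ hw

/-- `mem_inertiaSubgroup_iff`: simp/rfl bookkeeping rule for the generic inertia tools, VERBATIM from the lens file (docstring added by the writer for the gate's docstring lint); the statement is its type. [new; elementary] [folklore] -/
theorem mem_inertiaSubgroup_iff {G : Type*} [Group G] (φ : G →* (E ≃+* E))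
    (hGO : ∀ g : G, ∀ y : E, y ∈ OE ↔ φ g y ∈ OE) (g : G) :
    g ∈ inertiaSubgroup OE φ hGO ↔ ∀ y ∈ OE, OE.valuation (φ g y - y) < 1 := Iff.rfl

/-- The inertia subgroup is normal. [folklore] -/
theorem conj_mem_inertiaSubgroup {G : Type*} [Group G] (φ : G →* (E ≃+* E))
    (hGO : ∀ g : G, ∀ y : E, y ∈ OE ↔ φ g y ∈ OE) (g : G) {t : G}
    (ht : t ∈ inertiaSubgroup OE φ hGO) : g * t * g⁻¹ ∈ inertiaSubgroup OE φ hGO := by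
  rw [mem_inertiaSubgroup_iff] at ht ⊢
  intro y hy
  have hw : φ g⁻¹ y ∈ OE := (hGO g⁻¹ y).mp hy
  have h2 : φ g (φ g⁻¹ y) = y := by
    rw [← RingAut.mul_apply, ← map_mul, mul_inv_cancel, map_one, RingAut.one_apply]
  have h1 : φ (g * t * g⁻¹) y - y = φ g (φ t (φ g⁻¹ y) - φ g⁻¹ y) := by
    rw [map_sub, h2, map_mul, map_mul, RingAut.mul_apply, RingAut.mul_apply]
  rw [h1]
  exact InvariantDescentLU.valuation_apply_lt_one OE (hGO g) (ht _ hw)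

/-- **`|T| ∈ O_E^×`** for the inertia subgroup `T` of a finite group of exponent (on `T`) dividing `e ∈ O_E^×`
(Cauchy: a `t ∈ T` of prime order `p ∣ |T|` has `t ^ e = 1`, so `p ∣ e`). [folklore] -/
theorem valuation_card_inertiaSubgroup {G : Type*} [Group G] [Finite G] (φ : G →* (E ≃+* E))
    (hGO : ∀ g : G, ∀ y : E, y ∈ OE ↔ φ g y ∈ OE) {e : ℕ}
    (hve : OE.valuation (e : E) = 1) (hexp : ∀ g ∈ inertiaSubgroup OE φ hGO, g ^ e = 1) :
    OE.valuation (Nat.card (inertiaSubgroup OE φ hGO) : E) = 1 := by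
  by_contra hne
  have hlt : OE.valuation (Nat.card (inertiaSubgroup OE φ hGO) : E) < 1 :=
    lt_of_le_of_ne ((OE.valuation_le_one_iff _).mpr (natCast_mem OE _)) hne
  obtain ⟨p, hp, hpN, hvp⟩ :=
    exists_prime_dvd_of_valuation_natCast_lt_one OE _ Nat.card_pos hlt
  haveI : Fact p.Prime := ⟨hp⟩
  obtain ⟨t, ht⟩ := exists_prime_orderOf_dvd_card' p hpN
  have hte : t ^ e = 1 := by
    apply Subtype.ext
    rw [Subgroup.coe_pow, Subgroup.coe_one]
    exact hexp _ t.2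
  have hpe : p ∣ e := ht ▸ orderOf_dvd_of_pow_eq_one hte
  obtain ⟨e', rfl⟩ := hpe
  have h1 : OE.valuation ((p * e' : ℕ) : E) < 1 := by
    rw [Nat.cast_mul, map_mul]
    calc OE.valuation (p : E) * OE.valuation (e' : E)
        ≤ OE.valuation (p : E) * 1 :=
          mul_le_mul' le_rfl ((OE.valuation_le_one_iff _).mpr (natCast_mem OE e'))
      _ < 1 := by rw [mul_one]; exact hvp
  exact absurd hve h1.ne

/-- **INERTIA SEPARATOR.**  `G` a finite group acting on `E` by `O_E`-stable automorphisms, `T ⊴ G` its inertia subgroup,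
of exponent dividing `e` with `e ∈ O_E^×`.  Then there is `x ∈ O_E` FIXED BY `T` with `v(x − g x) = 1` for every `g ∉ T`:
lift a separating element `θ̄` of the residue field for the finite group of residue automorphisms `Ḡ ≅ G/T` (Mathlib's
Artin / primitive element through `FiniteAutSeparator.exists_separator`) to `y₀ ∈ O_E` and take the `T`-orbit sum
`x = ∑_{t ∈ T} t y₀ ≡ |T|·y₀ (mod 𝔪)`, `|T| ∈ O_E^×` (`valuation_card_inertiaSubgroup`). [folklore; ZS75 VI §12; Ser79 I §7] -/
theorem exists_inertia_separator {G : Type*} [Group G] [Fintype G] (φ : G →* (E ≃+* E))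
    (hGO : ∀ g : G, ∀ y : E, y ∈ OE ↔ φ g y ∈ OE) {e : ℕ}
    (hve : OE.valuation (e : E) = 1) (hexp : ∀ g ∈ inertiaSubgroup OE φ hGO, g ^ e = 1) :
    ∃ x ∈ OE, (∀ g ∈ inertiaSubgroup OE φ hGO, φ g x = x) ∧
      (∀ g : G, g ∉ inertiaSubgroup OE φ hGO → OE.valuation (x - φ g x) = 1) := by
  classical
  set Tsub := inertiaSubgroup OE φ hGO with hTsub
  have hmemT : ∀ g : G, g ∈ Tsub ↔ ∀ y ∈ OE, OE.valuation (φ g y - y) < 1 := fun g => Iff.rfl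
  -- values are `G`-invariant (finite order)
  have hgv : ∀ g : G, ∀ y : E, OE.valuation (φ g y) = OE.valuation y := fun g y =>
    valuation_apply_eq OE (hGO g) (orderOf_pos g) (by rw [← map_pow, pow_orderOf_eq_one, map_one]) y
  -- `|T| ∈ O_E^×`
  set N : ℕ := Fintype.card Tsub with hN
  have hvN : OE.valuation (N : E) = 1 := by
    rw [hN, ← Nat.card_eq_fintype_card]
    exact valuation_card_inertiaSubgroup OE φ hGO hve hexp
  -- residue automorphisms `Ḡ`
  let Φ : G → (ResidueField OE ≃+* ResidueField OE) := fun g => resAut OE (φ g) (hGO g)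
  let Gbar : Finset (ResidueField OE ≃+* ResidueField OE) := Finset.univ.image Φ
  have hΦ1 : Φ 1 = 1 := (resAut_eq_one_iff OE _ _).mpr (Tsub.one_mem)
  have hΦmul : ∀ g h : G, Φ (g * h) = Φ g * Φ h := fun g h =>
    resAut_comp OE (hGO g) (hGO h) (hGO (g * h)) (fun y => by rw [map_mul]; rfl)
  have h1 : (1 : ResidueField OE ≃+* ResidueField OE) ∈ Gbar :=
    Finset.mem_image.mpr ⟨1, Finset.mem_univ _, hΦ1⟩
  have hmul : ∀ a ∈ Gbar, ∀ b ∈ Gbar, a * b ∈ Gbar := by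
    intro a ha b hb
    obtain ⟨g, -, rfl⟩ := Finset.mem_image.mp ha
    obtain ⟨h, -, rfl⟩ := Finset.mem_image.mp hb
    exact Finset.mem_image.mpr ⟨g * h, Finset.mem_univ _, hΦmul g h⟩
  obtain ⟨θ, hθ⟩ := FiniteAutSeparator.exists_separator Gbar h1 hmul
  obtain ⟨y₀, hy₀⟩ := residue_surjective θ
  -- `g ∉ T` moves `y₀` to residual distance `1`
  have hsep0 : ∀ g : G, g ∉ Tsub → OE.valuation (φ g y₀ - y₀) = 1 := by
    intro g hg
    have hΦg : Φ g ≠ 1 := fun h => hg ((hmemT g).mpr ((resAut_eq_one_iff OE _ _).mp h))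
    have hθg : Φ g θ ≠ θ := fun h =>
      hΦg (hθ _ (Finset.mem_image.mpr ⟨g, Finset.mem_univ _, rfl⟩) h)
    have hres : residue OE (restrictO OE (φ g) (hGO g) y₀) ≠ residue OE y₀ := by
      rw [← resAut_residue, hy₀]; exact hθg
    have hnot : ¬ OE.valuation (φ g y₀ - y₀) < 1 := by
      intro hlt
      apply hres
      have h2 : restrictO OE (φ g) (hGO g) y₀ - y₀ ∈ maximalIdeal OE :=
        (ValuationSubring.valuation_lt_one_iff OE _).mpr (by simpa using hlt)
      rw [← sub_eq_zero, ← map_sub, residue_eq_zero_iff]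
      exact h2
    exact valuation_eq_one_of_not_lt OE (sub_mem ((hGO g _).mp y₀.2) y₀.2) hnot
  -- the `T`-orbit sum
  let x : E := ∑ t : Tsub, φ (t : G) (y₀ : E)
  have hxO : x ∈ OE := sum_mem fun t _ => (hGO (t : G) _).mp y₀.2
  have hxT : ∀ g ∈ Tsub, φ g x = x := by
    intro g hgT
    show φ g (∑ t : Tsub, φ (t : G) (y₀ : E)) = ∑ t : Tsub, φ (t : G) (y₀ : E)
    rw [map_sum]
    have h2 : ∀ t : Tsub, φ g (φ (t : G) (y₀ : E)) =
        (fun s : Tsub => φ (s : G) (y₀ : E)) (Equiv.mulLeft (⟨g, hgT⟩ : Tsub) t) := by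
      intro t
      simp only [Equiv.coe_mulLeft, Subgroup.coe_mul, map_mul, RingAut.mul_apply]
    simp_rw [h2]
    exact Equiv.sum_comp (Equiv.mulLeft (⟨g, hgT⟩ : Tsub)) (fun s : Tsub => φ (s : G) (y₀ : E))
  -- `x ≡ |T|·y₀ (mod 𝔪)`
  set w : E := x - (N : E) * y₀ with hw
  have hvw : OE.valuation w < 1 := by
    have h1 : w = ∑ t : Tsub, (φ (t : G) (y₀ : E) - y₀) := by
      rw [hw, Finset.sum_sub_distrib, Finset.sum_const, Finset.card_univ, hN, nsmul_eq_mul]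
    rw [h1]
    exact Valuation.map_sum_lt _ one_ne_zero fun t _ => (hmemT _).mp t.2 _ y₀.2
  refine ⟨x, hxO, hxT, fun g hg => ?_⟩
  have hdec : x - φ g x = (N : E) * (y₀ - φ g y₀) + (w - φ g w) := by
    rw [hw, map_sub, map_mul, map_natCast]; ring
  have hv1 : OE.valuation ((N : E) * (y₀ - φ g y₀)) = 1 := by
    rw [map_mul, hvN, one_mul, Valuation.map_sub_swap]; exact hsep0 g hg
  have hv2 : OE.valuation (w - φ g w) < 1 := by
    refine lt_of_le_of_lt (Valuation.map_sub _ _ _) (max_lt hvw ?_)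
    rw [hgv]; exact hvw
  rw [hdec, Valuation.map_add_eq_of_lt_left _ (lt_of_lt_of_eq hv2 hv1.symm), hv1]

end GenericA

end Summit.ResolutionOfSingularities.ResolutionOfSingularities.Theorems.TameTwoStoreyLU

end
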